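import Literature.Analysis.FluidPDE.OnsagerBDSV
import HarnessLib

/-!
# The BDSV scheme: the mollification and gluing scales and the stage estimates consumed by the
# proof of the main proposition (named fact)

Buckmaster–De Lellis–Székelyhidi–Vicol (BDSV), *Onsager's conjecture for admissible weak
solutions*, CPAM 72 (2019) = arXiv:1701.08678, prove their main iterative proposition (Prop. 2.1,
the named fact `BDSV.mainIteration` of `OnsagerBDSV.lean`) in three stages (§2.3):
mollification `(v_q, R̊_q) ↦ (v_ℓ, R̊_ℓ)` (§2.4, Prop. 2.2), gluing `(v_ℓ, R̊_ℓ) ↦ (v̄_q, R̊̄_q)`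
(§2.5, §§3–4) and perturbation by Mikado flows `(v̄_q, R̊̄_q) ↦ (v_{q+1}, R̊_{q+1})` (§2.6, §§5–6).
The "Proof of Proposition 2.1" printed at the end of §2.6 (p. 8 of the arXiv version) then
consumes exactly seven displayed estimates produced by the stages — (2.12), (2.13) with `N = 0`,
(2.18), (2.19) with `N = 0`, (2.23), (2.24) (in the form (6.1)) and (2.24c) (= Prop. 6.2) — and
closes the induction by triangle inequalities and the parameter inequality (2.25).

This file records

* the two further parameters of the scheme: the mollification length
  `ℓ = ℓ_q = δ_{q+1}^{1/2} δ_q^{-1/2} λ_q^{-1-3α/2}` (§2.4, (2.10)′, `BDSV.mollScale`) and the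
  gluing time scale `τ_q = ℓ^{2α} δ_q^{-1/2} λ_q^{-1}` (§2.5, (2.16), `BDSV.glueScale`);
* the **named fact** `BDSV.stagesEstimate`: under the hypotheses of Prop. 2.1 (same quantifier
  prefix, with the implicit constant `C = C(β, b, α, M)` of the symbol `≲` made explicit and fixed
  before `a`), the three stages produce fields `v_ℓ`, `v̄_q` and an Euler–Reynolds triple
  `(v_{q+1}, p_{q+1}, R̊_{q+1})` on `[0,T] × T³` satisfying the seven estimates above.

The assembly `BDSV.stagesEstimate → BDSV.mainIteration` (the printed proof of Prop. 2.1) is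
proved in `OnsagerBDSVStagesProofs.lean`; the parameter inequalities it needs ((2.9), (2.11),
(2.25)–(2.26)) are proved in `OnsagerBDSVParameters.lean`. The three stages themselves
(Prop. 2.2; Props. 4.2–4.4 with the support property (2.17); Cor. 5.8 and Props. 6.1–6.2), whose
statements need higher Hölder norms and material derivatives, are the subject of separate files;
`BDSV.stagesEstimate` is precisely the part of their output used in §2.6.

## Design choices

* Norm bounds are the predicates `BDSV.SupLE` (`‖f‖₀ ≤ B`) and `BDSV.DerivSupLE` (`[f]₁ ≤ B`) of
  `OnsagerBDSV.lean`, `‖f‖₁ = ‖f‖₀ + [f]₁ ≤ B` being rendered `∃ B₀ B₁, … ∧ B₀ + B₁ ≤ B`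
  exactly as in `BDSV.InductiveEstimates`; (2.23) is literally `BDSV.VelocityIncrementBound` with
  constant `M/2`.
* The implicit constants of `≲` in (2.12), (2.13), (2.18), (2.19), (2.24), (2.24c) ("the constant
  `C` depends on `α, β, M`, but not on `a, b` and `q`", §2.6; the constants of §§5–6 also depend on
  the number `N = N(b, β)` of derivatives used there) are one real `C` quantified after
  `M, β, b, α` and before `a₀`; no sign is imposed (the bounds force `C ≥ 0` whenever they are
  used).
* Of the auxiliary fields only what §2.6 uses is recorded: `v_ℓ` and `v̄_q` are smooth on every
  time slice (in the source they are `C^∞` on `[0,T] × T³`), with the bounds (2.12), (2.13)|₀,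
  (2.18), (2.19)|₀; the new triple is a classical Euler–Reynolds solution
  (`Torus.IsEulerReynoldsOn (Icc 0 T)`).
* (2.24) is recorded in the sup-norm form (6.1) `‖R̊_{q+1}‖₀ ≲ δ_{q+1}^{1/2} δ_q^{1/2} λ_q λ_{q+1}^{4α-1}`
  (BDSV's (2.24) bounds the stronger `‖R̊_{q+1}‖_α` by the same quantity; only `‖·‖₀` enters (2.3)).

## References

* T. Buckmaster, C. De Lellis, L. Székelyhidi Jr., V. Vicol, *Onsager's conjecture for admissible
  weak solutions*, Comm. Pure Appl. Math. 72 (2019) 229–274 = arXiv:1701.08678: §2.3 (stages),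
  §2.4 (2.10)–(2.13) (mollification, Prop. 2.2), §2.5 (2.16)–(2.19) (gluing), §2.6 (2.23)–(2.24c)
  and "Proof of Proposition 2.1", Cor. 5.8, Prop. 6.1 (6.1), Prop. 6.2.
-/

open MeasureTheory Set
open scoped NNReal ENNReal ContDiff

noncomputable section

namespace Literature.Analysis.FluidPDE

namespace BDSV

/-- The flat three-torus `T³ = (ℝ/ℤ)³`, local notation. -/
local notation "𝕋³" => UnitAddTorus (Fin 3)

/-- Euclidean `ℝ³`, local notation. -/
local notation "ℝ³" => EuclideanSpace ℝ (Fin 3)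

/-! ## The mollification length and the gluing time scale -/

section Scales

/-- The mollification length `ℓ = ℓ_q := δ_{q+1}^{1/2} / (δ_q^{1/2} λ_q^{1+3α/2})` of the BDSV
scheme (§2.4, display (2.10)′ defining `ℓ`), at which `v_q` is mollified in space.
[cite: BuckmasterEtAl2018, §2.4] -/
def mollScale (β α a b : ℝ) (q : ℕ) : ℝ :=
  Real.sqrt (amp β a b (q + 1)) / (Real.sqrt (amp β a b q) * freq a b q ^ (1 + 3 * α / 2))

/-- The gluing time scale `τ_q := ℓ^{2α} / (δ_q^{1/2} λ_q)` of the BDSV scheme (§2.5, (2.16)):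
the exact Euler solutions are glued on intervals of length `∼ τ_q`.
[cite: BuckmasterEtAl2018, §2.5 (2.16)] -/
def glueScale (β α a b : ℝ) (q : ℕ) : ℝ :=
  mollScale β α a b q ^ (2 * α) / (Real.sqrt (amp β a b q) * freq a b q)

/-- `ℓ > 0` for `a ≥ 1`. [folklore] -/
theorem mollScale_pos {β α a b : ℝ} (ha : 1 ≤ a) (q : ℕ) : 0 < mollScale β α a b q := by
  unfold mollScale
  have h1 := amp_pos (β := β) (b := b) ha (q + 1)
  have h2 := amp_pos (β := β) (b := b) ha q
  have h3 := freq_pos (b := b) ha q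
  have h4 : 0 < freq a b q ^ (1 + 3 * α / 2) := Real.rpow_pos_of_pos h3 _
  exact div_pos (Real.sqrt_pos.2 h1) (mul_pos (Real.sqrt_pos.2 h2) h4)

/-- `τ_q > 0` for `a ≥ 1`. [folklore] -/
theorem glueScale_pos {β α a b : ℝ} (ha : 1 ≤ a) (q : ℕ) : 0 < glueScale β α a b q := by
  unfold glueScale
  exact div_pos (Real.rpow_pos_of_pos (mollScale_pos ha q) _)
    (mul_pos (Real.sqrt_pos.2 (amp_pos ha q)) (freq_pos ha q))

end Scales

/-! ## The stage estimates consumed by the proof of Prop. 2.1 -/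

section Facts

/-- **BDSV stage estimates** (Buckmaster–De Lellis–Székelyhidi–Vicol 2019, §§2.4–2.6 with
Prop. 2.2, Props. 4.2–4.3, Cor. 5.8, Prop. 6.1 and Prop. 6.2: the seven displayed estimates
invoked in the "Proof of Proposition 2.1" at the end of §2.6). There is a universal `M > 0`
(Def. 5.6) such that for `0 < β < 1/3` and `1 < b < (1-β)/(2β)` there is `α₀ = α₀(β, b) > 0`
such that for every `0 < α < α₀` there are a constant `C = C(β, b, α, M)` (the implicit constant
of `≲`) and `a₀ = a₀(β, b, α, M) > 1` such that for every `a ≥ a₀` the following holds. Given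
`T > 0`, a normalised energy profile `e` on `[0,T]` (`BDSV.IsNormalisedProfile`: smooth,
strictly positive, `sup |e'| ≤ 1`, (2.1)) and an Euler–Reynolds triple `(v_q, p_q, R̊_q)` on
`[0,T] × T³` satisfying the inductive estimates (2.3)–(2.6) at stage `q`
(`BDSV.InductiveEstimates`), the mollification, gluing and perturbation stages produce fields
`v_ℓ` (§2.4) and `v̄_q` (§2.5), smooth on every time slice, and an Euler–Reynolds triple
`(v_{q+1}, p_{q+1}, R̊_{q+1})` on `[0,T] × T³` (§5.4) such that, with `ℓ = BDSV.mollScale`,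
(2.12) `‖v_ℓ - v_q‖₀ ≤ C δ_{q+1}^{1/2} λ_q^{-α}`; (2.13)|_{N=0} `‖v_ℓ‖₁ ≤ C δ_q^{1/2} λ_q`;
(2.18) `‖v̄_q - v_ℓ‖₀ ≤ C δ_{q+1}^{1/2} ℓ^α`; (2.19)|_{N=0} `‖v̄_q‖₁ ≤ C δ_q^{1/2} λ_q`;
(2.23) `‖v_{q+1} - v̄_q‖₀ + λ_{q+1}^{-1} ‖v_{q+1} - v̄_q‖₁ ≤ (M/2) δ_{q+1}^{1/2}` (Cor. 5.8);
(2.24) in the form (6.1) `‖R̊_{q+1}‖₀ ≤ C δ_{q+1}^{1/2} δ_q^{1/2} λ_q λ_{q+1}^{-1+4α}` (Prop. 6.1);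
(2.24c) `|e(t) - ∫_{T³} |v_{q+1}(x,t)|² dx - δ_{q+2}/2| ≤ C δ_q^{1/2} δ_{q+1}^{1/2} λ_q^{1+2α} λ_{q+1}^{-1}`
for all `t ∈ [0,T]` (Prop. 6.2). Here `‖·‖₀`, `[·]₁`, `‖·‖₁ = ‖·‖₀ + [·]₁` are BDSV's sup norms
on `[0,T] × T³` (App. A), transcribed by `BDSV.SupLE` / `BDSV.DerivSupLE` as in
`BDSV.InductiveEstimates`, and (2.23) is `BDSV.VelocityIncrementBound` with constant `M/2`.
[cite: BuckmasterEtAl2018, §2.6 (Proof of Proposition 2.1)] -/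
def stagesEstimate : Prop :=
  ∃ M : ℝ, 0 < M ∧
    ∀ β : ℝ, 0 < β → β < 1 / 3 → ∀ b : ℝ, 1 < b → b < (1 - β) / (2 * β) →
      ∃ α₀ : ℝ, 0 < α₀ ∧ ∀ α : ℝ, 0 < α → α < α₀ →
        ∃ C a₀ : ℝ, 1 < a₀ ∧ ∀ a : ℝ, a₀ ≤ a →
          ∀ T : ℝ, 0 < T → ∀ e : ℝ → ℝ, IsNormalisedProfile T e →
            ∀ (q : ℕ) (v : ℝ → 𝕋³ → ℝ³) (p : ℝ → 𝕋³ → ℝ) (R : ℝ → 𝕋³ → Fin 3 → ℝ³),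
              Torus.IsEulerReynoldsOn (Icc 0 T) v p R →
              InductiveEstimates M β α a b T e q v R →
                ∃ (vℓ vbar v' : ℝ → 𝕋³ → ℝ³) (p' : ℝ → 𝕋³ → ℝ) (R' : ℝ → 𝕋³ → Fin 3 → ℝ³),
                  (∀ t ∈ Icc 0 T, FunctionSpaces.Torus.IsSmooth (vℓ t)) ∧
                  (∀ t ∈ Icc 0 T, FunctionSpaces.Torus.IsSmooth (vbar t)) ∧
                  Torus.IsEulerReynoldsOn (Icc 0 T) v' p' R' ∧
                  SupLE T (fun t x => vℓ t x - v t x)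
                    (C * (Real.sqrt (amp β a b (q + 1)) * freq a b q ^ (-α))) ∧
                  (∃ B₀ B₁ : ℝ, SupLE T vℓ B₀ ∧ DerivSupLE T vℓ B₁ ∧
                    B₀ + B₁ ≤ C * (Real.sqrt (amp β a b q) * freq a b q)) ∧
                  SupLE T (fun t x => vbar t x - vℓ t x)
                    (C * (Real.sqrt (amp β a b (q + 1)) * mollScale β α a b q ^ α)) ∧
                  (∃ B₀ B₁ : ℝ, SupLE T vbar B₀ ∧ DerivSupLE T vbar B₁ ∧
                    B₀ + B₁ ≤ C * (Real.sqrt (amp β a b q) * freq a b q)) ∧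
                  VelocityIncrementBound (M / 2) β a b T q (fun t x => v' t x - vbar t x) ∧
                  SupLE T R' (C * (Real.sqrt (amp β a b (q + 1)) * Real.sqrt (amp β a b q) *
                    freq a b q * freq a b (q + 1) ^ (-1 + 4 * α))) ∧
                  ∀ t ∈ Icc 0 T, |e t - (∫ x, ‖v' t x‖ ^ 2) - amp β a b (q + 2) / 2| ≤
                    C * (Real.sqrt (amp β a b q) * Real.sqrt (amp β a b (q + 1)) *
                      freq a b q ^ (1 + 2 * α) * (freq a b (q + 1))⁻¹)

end Facts

end BDSV

end Literature.Analysis.FluidPDE
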